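import Summits.Ventures.HSemireg.WedgeHankelSubstitution

/-!
# Venture HSemireg — THE GENERAL LINEAR SUBSTITUTION (2b): THE CATALECTICANT IS EQUIVARIANT AS A MATRIX — the moment transform is MULTIPLICATIVE over degrees
# (`sbSeq (k+e) q (a+s) = sbSeq k (l ↦ sbSeq e (σ^l q) s) a`), hence `H_k(sbSeq g n q) = S_k(g) · H_k(q) · S_{n−k}(g)ᵀ` with `S_c(g)` the matrix of the degree-`c` moment transform

HONEST FRAMING. Part of the Lean index of the computation cell `pub-hsemireg` (seat p10 gen 18, Sunday typer «UNIFORM-IN-n»).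
LINEAR ALGEBRA of Hankel (catalecticant) matrices + th-7's sequence vocabulary ONLY: no variety, no cohomology theory, no sheaf, no Ext group, no semiregularity map;
nothing here says that HC / HC_CM / HC_AV holds; no Literature fact is declared or used.  Custodian versions as in `WedgeHankelSiegelIdeal` (1/3) and `WedgeHankelFrameChange`;
the dictionary (the moments of a functional on binary forms; `S_c(g) = Sym^c` of the substitution on forms of degree `c`; `H_k` = the matrix of `(f, h) ↦ L(f·h)`, `deg f = k`, `deg h = n − k`)
is QUOTED, never asserted.

WHAT IS IN THE TREE.  H1 `WedgeHankelSubstitution` (this seat, 899): `sbSeq` by the double recursion, `sbSeq_succ_of_le` (the `x`-identity), `sbSeq_add` / `sbSeq_smul` / `sbSeq_zero_seq`,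
`sbSeq_eq_zero_of_lt`; th-7 `hankel1` (`H_k(q) = (q_{a+s})`).  H1b (909) proves `rank H_k(sbSeq g n q) = rank H_k(q)` CLASS-SIDE (THEOREM H + transport); the MATRIX identity behind it was
named there as NOT typed.  THIS FILE types it (namespace `Summit.Ventures.HSemireg.Wedge.HankelFrameChange` continued):
* §142 `sbSeq_congr'` (the degree-`m` transform reads only `q_0, …, q_m`; every `m`), `sbSeq_finset_sum`, **`sbSeq_eq_sum_single`: `sbSeq m q a = Σ_{l ≤ m} q_l · sbSeq m δ_l a`** — the transform is
  a MATRIX `S_m(g) = (sbSeq m δ_l a)_{a,l}` (`sbMat`, `sbSeq_eq_sbMat_mulVec`-style entries `sbMat_apply`).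
* §143 **MULTIPLICATIVITY `sbSeq_add_add`: `sbSeq (k+e) q (a+s) = sbSeq k (l ↦ sbSeq e (σ^l q) s) a` for `a ≤ k`, `s ≤ e`** — the degree-`(k+e)` moment `(a+s)` is the degree-`k` transform, in
  the shift variable `l`, of the degree-`e` moments `s` of the shifted sequences (induction on `k`: the `y`-recursion commutes with `l ↦ σ^l`, the `x`-identity handles `a = 0`); dictionary:
  `(αu+γv)^{(k+e)−(a+s)}(βu+δv)^{a+s}` is the product of the degree-`k` and degree-`e` monomials' transforms.  `shift_iterate_apply` (`(σ^l q)_i = q_{i+l}`).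
* §144 **`hankel1_sbSeq`: `H_k(sbSeq α β γ δ n q) = S_k · H_k(q) · S_{n−k}ᵀ`** (`k ≤ n`; `S_c = sbMat c (c+1)`, the `(c+1) × (c+1)` matrix of the degree-`c` transform) — THE CATALECTICANT OF A
  BINARY FORM IS `GL₂`-EQUIVARIANT AS A MATRIX, for EVERY substitution (singular included); `rank_hankel1_sbSeq_le` (`rank H_k(sbSeq g n q) ≤ rank H_k(q)` for every `g`) follows at once
  (H1b's equality for `det ≠ 0` is the class-side statement; the inverse matrix `S_c(g⁻¹)` is H1b's `sbSeq_inv_apply`).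
NOT typed here: `S_c(g)` as `Sym^c(g)` in a monomial basis of binary forms (no binary forms are constructed; dictionary only); `det S_c(g) = (det g)^{c(c+1)/2}`; anything class- or Ext-side.
New names only.
-/

open Module
open scoped Matrix

namespace Summit.Ventures.HSemireg.Wedge.HankelFrameChange

open Summit.Ventures.HSemireg.Wedge Summit.Ventures.HSemireg.Wedge.Hankel

variable (K : Type*) [Field K]

/-! ## §142. The moment transform is a matrix -/

/-- the degree-`m` transform reads only `q_0, …, q_m` (every `m`; cf. H1b `sbSeq_congr` for `m = n` via the class). -/
theorem sbSeq_congr' (α β γ δ : K) : ∀ (m : ℕ) {q q' : ℕ → K}, (∀ j ≤ m, q j = q' j) → ∀ j : ℕ, sbSeq K α β γ δ m q j = sbSeq K α β γ δ m q' j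
  | 0, _, _, h, 0 => by rw [sbSeq_zero_zero, sbSeq_zero_zero, h 0 le_rfl]
  | 0, _, _, _, _ + 1 => rfl
  | m + 1, q, q', h, 0 => by
    rw [sbSeq_succ_zero, sbSeq_succ_zero, sbSeq_congr' α β γ δ m (q := q) (q' := q') (fun j hj => h j (by omega)) 0,
      sbSeq_congr' α β γ δ m (q := shift K q) (q' := shift K q') (fun j hj => h (j + 1) (by omega)) 0]
  | m + 1, q, q', h, j + 1 => by
    rw [sbSeq_succ_succ, sbSeq_succ_succ, sbSeq_congr' α β γ δ m (q := q) (q' := q') (fun j hj => h j (by omega)) j,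
      sbSeq_congr' α β γ δ m (q := shift K q) (q' := shift K q') (fun j hj => h (j + 1) (by omega)) j]

/-- the transform of a finite sum of sequences. -/
theorem sbSeq_finset_sum (α β γ δ : K) {ι : Type*} (s : Finset ι) (f : ι → ℕ → K) (m j : ℕ) :
    sbSeq K α β γ δ m (fun i => ∑ l ∈ s, f l i) j = ∑ l ∈ s, sbSeq K α β γ δ m (f l) j := by
  classical
  induction s using Finset.induction_on with
  | empty =>
    simp only [Finset.sum_empty]
    exact sbSeq_zero_seq K α β γ δ m j
  | insert a s ha ih =>
    simp only [Finset.sum_insert ha]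
    rw [← ih]
    exact sbSeq_add K α β γ δ m (f a) (fun i => ∑ l ∈ s, f l i) j

/-- **THE TRANSFORM IS A MATRIX: `sbSeq m q a = Σ_{l ≤ m} q_l · sbSeq m δ_l a`.** -/
theorem sbSeq_eq_sum_single (α β γ δ : K) (m : ℕ) (q : ℕ → K) (a : ℕ) :
    sbSeq K α β γ δ m q a = ∑ l ∈ Finset.range (m + 1), q l * sbSeq K α β γ δ m (fun i => if i = l then (1 : K) else 0) a := by
  have e : ∀ j ≤ m, q j = ∑ l ∈ Finset.range (m + 1), q l * (if j = l then (1 : K) else 0) := fun j hj => by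
    rw [Finset.sum_eq_single j]
    · rw [if_pos rfl, mul_one]
    · intro l _ hl; rw [if_neg (Ne.symm hl), mul_zero]
    · intro h; exact absurd (Finset.mem_range.mpr (by omega)) h
  rw [sbSeq_congr' K α β γ δ m (q' := fun j => ∑ l ∈ Finset.range (m + 1), q l * (if j = l then (1 : K) else 0)) (fun j hj => e j hj) a,
    sbSeq_finset_sum]
  exact Finset.sum_congr rfl fun l _ => sbSeq_smul K α β γ δ (q l) m _ a

/-- **THE MATRIX `S_c` OF THE DEGREE-`c` MOMENT TRANSFORM** in size `d` (use `d = c + 1`): `(a, l) ↦ sbSeq c δ_l a`. -/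
def sbMat (α β γ δ : K) (c d : ℕ) : Matrix (Fin d) (Fin d) K :=
  Matrix.of fun a l => sbSeq K α β γ δ c (fun i => if i = (l : ℕ) then (1 : K) else 0) a

/-- entries of `sbMat`. -/
lemma sbMat_apply (α β γ δ : K) (c d : ℕ) (a l : Fin d) : sbMat K α β γ δ c d a l = sbSeq K α β γ δ c (fun i => if i = (l : ℕ) then (1 : K) else 0) a := rfl

/-- `sbSeq c q a = (S_c · q|[0,c])_a` for `a ≤ c` (matrix form of `sbSeq_eq_sum_single` in size `c + 1`). -/
theorem sbSeq_eq_sbMat_sum (α β γ δ : K) (c : ℕ) (q : ℕ → K) (a : Fin (c + 1)) :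
    sbSeq K α β γ δ c q a = ∑ l : Fin (c + 1), sbMat K α β γ δ c (c + 1) a l * q l := by
  rw [sbSeq_eq_sum_single, ← Fin.sum_univ_eq_sum_range (fun l => q l * sbSeq K α β γ δ c (fun i => if i = l then (1 : K) else 0) a)]
  exact Finset.sum_congr rfl fun l _ => by rw [sbMat_apply, mul_comm]

/-! ## §143. Multiplicativity over degrees -/

omit [Field K] in
/-- iterated shifts: `(σ^l q)_i = q_{i+l}`. -/
lemma shift_iterate_apply (q : ℕ → K) : ∀ (l i : ℕ), (shift K)^[l] q i = q (i + l)
  | 0, i => rfl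
  | l + 1, i => by rw [Function.iterate_succ_apply', shift_apply, shift_iterate_apply q l (i + 1), Nat.add_right_comm, Nat.add_assoc]

/-- **MULTIPLICATIVITY OF THE MOMENT TRANSFORM: `sbSeq (k + e) q (a + s) = sbSeq k (l ↦ sbSeq e (σ^l q) s) a` for `a ≤ k`, `s ≤ e`** — the degree-`(k+e)` moment `a + s` is the degree-`k`
transform (in the shift variable) of the degree-`e` moments `s` of the shifted sequences.  Induction on `k`: at `a = 0` the `x`-identity, at `a + 1` the `y`-recursion, and `σ` commutes with
`l ↦ σ^l`. -/
theorem sbSeq_add_add (α β γ δ : K) {e s : ℕ} (hs : s ≤ e) :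
    ∀ (k : ℕ) (q : ℕ → K) {a : ℕ}, a ≤ k → sbSeq K α β γ δ (k + e) q (a + s) = sbSeq K α β γ δ k (fun l => sbSeq K α β γ δ e ((shift K)^[l] q) s) a
  | 0, q, 0, _ => by rw [Nat.zero_add, Nat.zero_add, sbSeq_zero_zero, Function.iterate_zero, id_eq]
  | k + 1, q, 0, _ => by
    have e1 := sbSeq_add_add α β γ δ hs k q (a := 0) (Nat.zero_le k)
    have e2 := sbSeq_add_add α β γ δ hs k (shift K q) (a := 0) (Nat.zero_le k)
    rw [Nat.zero_add] at e1 e2 ⊢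
    rw [show k + 1 + e = (k + e) + 1 by omega, sbSeq_succ_of_le K α β γ δ (k + e) q (show s ≤ k + e by omega), sbSeq_succ_zero, e1, e2]
    rfl
  | k + 1, q, a + 1, ha => by
    rw [show k + 1 + e = (k + e) + 1 by omega, show a + 1 + s = (a + s) + 1 by omega, sbSeq_succ_succ, sbSeq_succ_succ,
      sbSeq_add_add α β γ δ hs k q (show a ≤ k by omega), sbSeq_add_add α β γ δ hs k (shift K q) (show a ≤ k by omega)]
    rfl

/-! ## §144. The catalecticant is equivariant as a matrix -/

/-- **`H_k(sbSeq α β γ δ n q) = S_k · H_k(q) · S_{n−k}ᵀ` for `k ≤ n`** (`S_c = sbMat c (c+1)`; EVERY substitution, singular included) — THE CATALECTICANT OF A BINARY FORM IS `GL₂`-EQUIVARIANT AS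
A MATRIX (dictionary quoted).  The column size `n + 1 − k` of th-7's `hankel1` is `(n − k) + 1`; the statement casts along that equality of sizes. -/
theorem hankel1_sbSeq {n k : ℕ} (hk : k ≤ n) (α β γ δ : K) (q : ℕ → K) (a : Fin (k + 1)) (s : Fin (n + 1 - k)) :
    hankel1 K n k (sbSeq K α β γ δ n q) a s =
      ∑ l : Fin (k + 1), ∑ l' : Fin (n + 1 - k), sbMat K α β γ δ k (k + 1) a l * hankel1 K n k q l l' * sbMat K α β γ δ (n - k) (n + 1 - k) s l' := by
  have hs : (s : ℕ) ≤ n - k := by have := s.2; omega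
  have h1 := sbSeq_add_add K α β γ δ hs k q (a := a) (by have := a.2; omega)
  rw [show k + (n - k) = n by omega] at h1
  rw [hankel1, Matrix.of_apply, h1, sbSeq_eq_sbMat_sum]
  refine Finset.sum_congr rfl fun l _ => ?_
  -- the inner degree-(n−k) transform of the shifted sequence, as a matrix row
  have e : sbSeq K α β γ δ (n - k) ((shift K)^[(l : ℕ)] q) s = ∑ l' : Fin (n + 1 - k), sbMat K α β γ δ (n - k) (n + 1 - k) s l' * q ((l : ℕ) + (l' : ℕ)) := by
    rw [sbSeq_eq_sum_single, show n - k + 1 = n + 1 - k by omega,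
      ← Fin.sum_univ_eq_sum_range (fun l' => (shift K)^[(l : ℕ)] q l' * sbSeq K α β γ δ (n - k) (fun i => if i = l' then (1 : K) else 0) s)]
    exact Finset.sum_congr rfl fun l' _ => by rw [sbMat_apply, shift_iterate_apply, mul_comm, Nat.add_comm (l' : ℕ) (l : ℕ)]
  rw [e, Finset.mul_sum]
  exact Finset.sum_congr rfl fun l' _ => by rw [hankel1, Matrix.of_apply]; ring

/-- the same as a product of matrices: **`H_k(sbSeq g n q) = S_k * H_k(q) * S_{n−k}ᵀ`.** -/
theorem hankel1_sbSeq_eq_mul {n k : ℕ} (hk : k ≤ n) (α β γ δ : K) (q : ℕ → K) :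
    hankel1 K n k (sbSeq K α β γ δ n q) = sbMat K α β γ δ k (k + 1) * hankel1 K n k q * (sbMat K α β γ δ (n - k) (n + 1 - k))ᵀ := by
  ext a s
  rw [hankel1_sbSeq K hk, Matrix.mul_apply, Finset.sum_comm]
  refine Finset.sum_congr rfl fun l' _ => ?_
  rw [Matrix.mul_apply, Matrix.transpose_apply, Finset.sum_mul]

/-- hence **`rank H_k(sbSeq g n q) ≤ rank H_k(q)` for EVERY substitution `g`** (singular included; `k ≤ n`) — by matrices alone (H1b: equality for `det g ≠ 0`, class side). -/
theorem rank_hankel1_sbSeq_le {n k : ℕ} (hk : k ≤ n) (α β γ δ : K) (q : ℕ → K) :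
    (hankel1 K n k (sbSeq K α β γ δ n q)).rank ≤ (hankel1 K n k q).rank := by
  rw [hankel1_sbSeq_eq_mul K hk]
  exact (Matrix.rank_mul_le_left _ _).trans (Matrix.rank_mul_le_right _ _)

end Summit.Ventures.HSemireg.Wedge.HankelFrameChange
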